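import Summits.Ventures.PercRepro.RankLevelSetHallRuleLExact

/-!
# PercRepro — THE LOST-SET INJECTION: THE UP-HALL FORM AT THE TIGHT LAYER FROM AN INJECTION OF THE LOST SETS INTO THE
BIG `Y`-SETS (p4, gen 33; C-044, UP form; paper proofs/P4-CELL-THREE.md §14.20)

At the tight layer `#E = p + q` the Boolean middle levels through a family `𝒜` of members carry weight `Φ(p,q)·#𝒜`
(each set `S` with `q < #S < p` gives `1/C(#S, q)` to every `q`-subset): `Φ(p,q)·#𝒜 ≤ #{S : q < #S < p, S ⊇ some Z ∈ 𝒜}`.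
The sets counted there but NOT in `Y` are the **lost sets** — `r(S) = q`, i.e. `S ⊆ cl Z` — and `Y` has in addition the
**big sets** `T` with `#T ≥ p` and `q < r(T) < p`.  So the UP-Hall form `Φ(p,q)·#𝒜 ≤ #upNbhd(𝒜)` follows from ANY injection
`φ` of the lost sets into the big `Y`-sets with `S ⊆ φ S` (`LostInj M p q`, a `Prop`, NOT asserted): a lost `S ⊇ Z ∈ 𝒜`
goes to `φ S ⊇ S ⊇ Z`, a big `Y`-set through `𝒜`.  In the vocabulary of the fractional `Φ`-matchings (night-1's
`hallUp_of_fracMatching`): the middle levels keep Rule L's LYM split, and a big set `T = φ S` passes the unit of its lost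
set `S` to the members inside `S`, `1/C(#S, q)` each — loads `≤ 1` by injectivity (`lostInjWeight_load_le_one`), receipts
exactly `Φ(p,q)` (`lostInjWeight_recv_eq_phiK`: the middle levels give `Φ − δ(Z)` by `ruleLMid_eq`, the lost sets through
`Z` are the `Z ∪ X`, `∅ ≠ X ⊆ flatPart Z`, `#X ≤ k−1`, and return `δ(Z)` — `sum_lost_through_eq_lymDefect`).
Rule C (gen 32) is the fractional version of this injection supported on the `p`-sets (one lost set spread uniformly over
its `C(#D, k−#X)` completions), false at large `q`; `LostInj` may use big sets of EVERY size `≥ p` and is tested by an exact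
maximum-matching computation on the cell's catalogues (every matroid with `≤ 9` elements: 0 failures, §14.20).
* `lostSets`, `bigY`, `LostInj`, `lostInjWeight`;
* `sum_lost_through_eq_lymDefect` — the lost sets through a member carry exactly its LYM defect;
* `lostInjWeight_load_le_one`, `lostInjWeight_recv_eq_phiK`;
* **`hallUp_of_ncard_eq_of_lostInj`** — `#E = p + q`, `q < p`, `LostInj M p q` ⇒ `Φ(p,q)·#𝒜 ≤ #upNbhd(𝒜)` for every family.
Axioms: standard.
-/

namespace PercRepro

open Set Matroid Finset

variable {α : Type} (M : Matroid α) [M.Finite]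

/-- The **lost sets** of the cell `(p, q)`: the `S ⊆ E` of rank `q` with `q < #S < p` containing a member — the sets of
the Boolean middle levels through a member that are NOT in `Y` (they lie inside the closure of the member). -/
def lostSets (p q : ℕ) : Set (Set α) :=
  {S : Set α | S ⊆ M.E ∧ M.eRk S = (q : ℕ∞) ∧ q < S.ncard ∧ S.ncard < p ∧ ∃ Z ∈ cellMembers M p q, Z ⊆ S}

/-- The **big `Y`-sets**: the `T ∈ Y` with `#T ≥ p`. -/
def bigY (p q : ℕ) : Set (Set α) := {T : Set α | T ∈ cellY M p q ∧ p ≤ T.ncard}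

/-- **(INJ)** — a `Prop`, NOT asserted: an injection `φ` of the lost sets into the big `Y`-sets with `S ⊆ φ S`. -/
def LostInj (p q : ℕ) : Prop :=
  ∃ φ : Set α → Set α, (∀ S ∈ lostSets M p q, φ S ∈ bigY M p q ∧ S ⊆ φ S) ∧ Set.InjOn φ (lostSets M p q)

/-- The lost sets form a finite family. -/
theorem lostSets_finite (p q : ℕ) : (lostSets M p q).Finite :=
  M.ground_finite.finite_subsets.subset (fun _ hS => hS.1)

/-- **The weight of the lost-set injection**: Rule L's LYM split on the middle levels (`#T < p`); on a big set `T`, every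
lost set `S` with `φ S = T` passes `1/C(#S, q)` to each member inside `S`. -/
noncomputable def lostInjWeight (p q : ℕ) (φ : Set α → Set α) (Z T : Set α) : ℚ := by
  classical
  exact if T.ncard < p then ruleLWeight M p q Z T
    else ∑ S ∈ (lostSets_finite M p q).toFinset,
      (if Z ⊆ S ∧ φ S = T then 1 / ((S.ncard.choose q : ℕ) : ℚ) else 0)

/-- The weights are non-negative. -/
theorem lostInjWeight_nonneg (p q : ℕ) (φ : Set α → Set α) (Z T : Set α) : 0 ≤ lostInjWeight M p q φ Z T := by
  classical
  unfold lostInjWeight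
  split_ifs with h
  · exact ruleLWeight_nonneg M p q Z T
  · refine Finset.sum_nonneg (fun S _ => ?_)
    split_ifs <;> positivity

/-- The weights are supported on the pairs `Z ⊆ T` (the lost sets go to supersets). -/
theorem subset_of_lostInjWeight_ne_zero (p q : ℕ) (φ : Set α → Set α)
    (hφ : ∀ S ∈ lostSets M p q, S ⊆ φ S) (Z T : Set α) (h : lostInjWeight M p q φ Z T ≠ 0) : Z ⊆ T := by
  classical
  unfold lostInjWeight at h
  split_ifs at h with hT
  · exact subset_of_ruleLWeight_ne_zero M p q Z T h
  · obtain ⟨S, hS, hne⟩ := Finset.exists_ne_zero_of_sum_ne_zero h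
    rw [(lostSets_finite M p q).mem_toFinset] at hS
    by_cases hc : Z ⊆ S ∧ φ S = T
    · rw [← hc.2]
      exact hc.1.trans (hφ S hS)
    · rw [if_neg hc] at hne
      exact absurd rfl hne

open Classical in
/-- **The lost sets through a member carry exactly its LYM defect**: at the tight layer, for a member `Z`,
`Σ_{S lost, Z ⊆ S} 1/C(#S, q) = δ(Z)` — the lost sets through `Z` are the `Z ∪ X`, `∅ ≠ X ⊆ flatPart Z`, `#X ≤ k−1`. -/
theorem sum_lost_through_eq_lymDefect (p q : ℕ) (hE : M.E.ncard = p + q) (hpq : q < p) {Z : Set α}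
    (hZ : Z ∈ cellMembers M p q) :
    ∑ S ∈ (lostSets_finite M p q).toFinset.filter (fun S => Z ⊆ S), 1 / ((S.ncard.choose q : ℕ) : ℚ)
      = lymDefect M p q Z := by
  classical
  -- the data of the member
  have hZE : Z ⊆ M.E := hZ.1
  have hEfin : M.E.Finite := M.ground_finite
  have hZfin : Z.Finite := hEfin.subset hZE
  have hZcard : Z.ncard = q := ncard_eq_q_of_mem_cellMembers_tight M hE hZ
  have hAfin : (M.E \ Z).Finite := hEfin.subset Set.sdiff_subset
  have hPsub : flatPart M Z ⊆ M.E \ Z := fun x hx => hx.1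
  have hPfin : (flatPart M Z).Finite := hAfin.subset hPsub
  set k := p - q with hk
  have hpk : p = q + k := by omega
  set Pf : Finset α := hPfin.toFinset with hPf
  have hPfcard : Pf.card = (flatPart M Z).ncard := by rw [hPf, ← ncard_eq_toFinset_card _ hPfin]
  have hqZ : M.eRk Z = (q : ℕ∞) := hZ.2.1
  have hmemP : ∀ X : Finset α, X ⊆ Pf → (X : Set α) ⊆ flatPart M Z := fun X hXP x hx => by
    have := hXP hx; rwa [hPf, hPfin.mem_toFinset] at this
  -- the lost sets through Z ↔ the subsets X of the flat part with 1 ≤ #X < k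
  have hlost : ∑ S ∈ (lostSets_finite M p q).toFinset.filter (fun S => Z ⊆ S), 1 / ((S.ncard.choose q : ℕ) : ℚ)
      = ∑ X ∈ Pf.powerset.filter (fun X => 1 ≤ X.card ∧ X.card < k), 1 / (((q + X.card).choose q : ℕ) : ℚ) := by
    symm
    refine Finset.sum_bij (fun X _ => Z ∪ (X : Set α)) ?_ ?_ ?_ ?_
    · -- maps into the lost sets through Z
      intro X hX
      rw [Finset.mem_filter, Finset.mem_powerset] at hX
      obtain ⟨hXP, hX1, hXk⟩ := hX
      have hXP' : (X : Set α) ⊆ flatPart M Z := hmemP X hXP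
      have hXA' : (X : Set α) ⊆ M.E \ Z := hXP'.trans hPsub
      have hXE : (X : Set α) ⊆ M.E := fun x hx => (hXA' hx).1
      have hdisj : Disjoint Z (X : Set α) := Set.disjoint_left.2 (fun x hxZ hxX => (hXA' hxX).2 hxZ)
      have hcard : (Z ∪ (X : Set α)).ncard = q + X.card := by
        rw [Set.ncard_union_eq hdisj hZfin X.finite_toSet, hZcard, Set.ncard_coe_finset]
      have hcl : (X : Set α) ⊆ M.closure Z := (subset_closure_iff_subset_flatPart M hXA').2 hXP'
      have hrk : M.eRk (Z ∪ (X : Set α)) = (q : ℕ∞) := by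
        rw [(eRk_union_eq_iff_subset_closure M hZE hXE).2 hcl, hqZ]
      rw [Finset.mem_filter, (lostSets_finite M p q).mem_toFinset]
      refine ⟨⟨Set.union_subset hZE hXE, hrk, ?_, ?_, Z, hZ, Set.subset_union_left⟩, Set.subset_union_left⟩
      · rw [hcard]; omega
      · rw [hcard]; omega
    · -- injective
      intro X₁ hX₁ X₂ hX₂ heq
      rw [Finset.mem_filter, Finset.mem_powerset] at hX₁ hX₂
      have h1 : ∀ X : Finset α, X ⊆ Pf → (Z ∪ (X : Set α)) \ Z = (X : Set α) := by
        intro X hXP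
        ext x
        constructor
        · intro hx
          rcases hx.1 with hxZ | hxX
          · exact absurd hxZ hx.2
          · exact hxX
        · intro hx
          exact ⟨Or.inr hx, (hPsub (hmemP X hXP hx)).2⟩
      have h2 : (Z ∪ (X₁ : Set α)) \ Z = (Z ∪ (X₂ : Set α)) \ Z := by rw [heq]
      rw [h1 X₁ hX₁.1, h1 X₂ hX₂.1] at h2
      exact Finset.coe_inj.1 h2
    · -- surjective
      intro S hS
      rw [Finset.mem_filter, (lostSets_finite M p q).mem_toFinset] at hS
      obtain ⟨⟨hSE, hqS, hSq, hSp, -⟩, hZS⟩ := hS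
      have hSfin : S.Finite := hEfin.subset hSE
      have hXfin : (S \ Z).Finite := hSfin.subset Set.sdiff_subset
      refine ⟨hXfin.toFinset, ?_, ?_⟩
      · rw [Finset.mem_filter, Finset.mem_powerset]
        have hXA : (S \ Z) ⊆ M.E \ Z := fun x hx => ⟨hSE hx.1, hx.2⟩
        have hXcl : (S \ Z) ⊆ M.closure Z := by
          rw [← eRk_union_eq_iff_subset_closure M hZE (fun x hx => hSE hx.1), Set.union_sdiff_cancel hZS, hqS, hqZ]
        have hXP : hXfin.toFinset ⊆ Pf := by
          intro x hx
          rw [hXfin.mem_toFinset] at hx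
          rw [hPf, hPfin.mem_toFinset]
          exact (subset_closure_iff_subset_flatPart M hXA).1 hXcl hx
        have hScard' : S.ncard = q + hXfin.toFinset.card := by
          rw [← ncard_eq_toFinset_card _ hXfin, ← hZcard, ← Set.ncard_union_eq (Set.disjoint_sdiff_right) hZfin hXfin,
            Set.union_sdiff_cancel hZS]
        exact ⟨hXP, by omega, by omega⟩
      · show Z ∪ ((hXfin.toFinset : Finset α) : Set α) = S
        rw [Set.Finite.coe_toFinset]
        exact Set.union_sdiff_cancel hZS
    · -- the values agree
      intro X hX
      rw [Finset.mem_filter, Finset.mem_powerset] at hX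
      have hXA' : (X : Set α) ⊆ M.E \ Z := (hmemP X hX.1).trans hPsub
      have hdisj : Disjoint Z (X : Set α) := Set.disjoint_left.2 (fun x hxZ hxX => (hXA' hxX).2 hxZ)
      rw [Set.ncard_union_eq hdisj hZfin X.finite_toSet, hZcard, Set.ncard_coe_finset]
  rw [hlost, Finset.sum_filter, sum_powerset_supported Pf k (fun j => 1 / (((q + j).choose q : ℕ) : ℚ)), hPfcard]
  unfold lymDefect
  rw [show p - q - 1 = k - 1 by omega]
  refine Finset.sum_congr rfl (fun i _ => ?_)
  rw [show q + (i + 1) = q + i + 1 by ring, mul_one_div]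

/-- **Every `Y`-set is loaded at most `1`** (tight layer): the middle levels by night-1's `ruleLWeight_load_le_one`, a big
set by the injectivity of `φ` — it is the image of at most one lost set `S`, which spreads one unit over the at most
`C(#S, q)` members inside it. -/
theorem lostInjWeight_load_le_one (p q : ℕ) (hE : M.E.ncard = p + q) (φ : Set α → Set α)
    (hinj : Set.InjOn φ (lostSets M p q)) (T : Set α) (hT : T ∈ cellY M p q) :
    ∑ Z ∈ (cellMembers_finite M p q).toFinset, lostInjWeight M p q φ Z T ≤ 1 := by
  classical
  set Mf : Finset (Set α) := (cellMembers_finite M p q).toFinset with hMf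
  set Lf : Finset (Set α) := (lostSets_finite M p q).toFinset with hLf
  have hmem : ∀ Z, Z ∈ Mf ↔ Z ∈ cellMembers M p q := fun Z => by
    rw [hMf, (cellMembers_finite M p q).mem_toFinset]
  have hmemL : ∀ S, S ∈ Lf ↔ S ∈ lostSets M p q := fun S => by
    rw [hLf, (lostSets_finite M p q).mem_toFinset]
  unfold lostInjWeight
  by_cases hsmall : T.ncard < p
  · simp only [if_pos hsmall]
    exact ruleLWeight_load_le_one M hE T hT
  · simp only [if_neg hsmall]
    rw [Finset.sum_comm]
    -- each lost set S with φ S = T contributes at most 1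
    have hS : ∀ S ∈ Lf, (∑ Z ∈ Mf, if Z ⊆ S ∧ φ S = T then 1 / ((S.ncard.choose q : ℕ) : ℚ) else 0)
        ≤ if φ S = T then 1 else 0 := by
      intro S hSL
      rw [hmemL] at hSL
      by_cases hφS : φ S = T
      · simp only [hφS, and_true, if_true]
        rw [Finset.sum_ite, Finset.sum_const_zero, add_zero, Finset.sum_const, nsmul_eq_mul]
        have hcount : (Mf.filter (fun Z => Z ⊆ S)).card ≤ S.ncard.choose q := by
          have h := ncard_members_subset_le_choose M hE hSL.1
          have heq : {Z : Set α | Z ∈ cellMembers M p q ∧ Z ⊆ S}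
              = ((Mf.filter (fun Z => Z ⊆ S) : Finset (Set α)) : Set (Set α)) := by
            ext Z
            rw [Finset.coe_filter, Set.mem_setOf_eq, Set.mem_setOf_eq, hmem]
          rw [heq, ncard_coe_finset] at h
          exact h
        have hpos : (0 : ℚ) < ((S.ncard.choose q : ℕ) : ℚ) := by
          exact_mod_cast Nat.choose_pos hSL.2.2.1.le
        rw [mul_one_div, div_le_one hpos]
        exact_mod_cast hcount
      · simp only [hφS, and_false, if_false]
        exact le_of_eq (Finset.sum_const_zero)
    refine (Finset.sum_le_sum hS).trans ?_
    rw [Finset.sum_boole]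
    have hcard : (Lf.filter (fun S => φ S = T)).card ≤ 1 := by
      rw [Finset.card_le_one]
      intro S₁ hS₁ S₂ hS₂
      rw [Finset.mem_filter, hmemL] at hS₁ hS₂
      exact hinj hS₁.1 hS₂.1 (hS₁.2.trans hS₂.2.symm)
    exact_mod_cast hcard

/-- **Every member receives exactly `Φ(p,q)`** (tight layer): `Φ − δ(Z)` from the middle levels (`ruleLMid_eq`) and
`δ(Z)` from the big sets `φ S` of its lost sets `S` (`sum_lost_through_eq_lymDefect`). -/
theorem lostInjWeight_recv_eq_phiK (p q : ℕ) (hE : M.E.ncard = p + q) (hpq : q < p) (φ : Set α → Set α)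
    (hφ : ∀ S ∈ lostSets M p q, φ S ∈ bigY M p q ∧ S ⊆ φ S) {Z : Set α} (hZ : Z ∈ cellMembers M p q) :
    ∑ T ∈ (cellY_finite M p q).toFinset, lostInjWeight M p q φ Z T = phiK p q := by
  classical
  set Yf : Finset (Set α) := (cellY_finite M p q).toFinset with hYf
  set Lf : Finset (Set α) := (lostSets_finite M p q).toFinset with hLf
  have hmemY : ∀ T, T ∈ Yf ↔ T ∈ cellY M p q := fun T => by
    rw [hYf, (cellY_finite M p q).mem_toFinset]
  have hmemL : ∀ S, S ∈ Lf ↔ S ∈ lostSets M p q := fun S => by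
    rw [hLf, (lostSets_finite M p q).mem_toFinset]
  -- the weight on a `Y`-set splits into the middle-level part and the big-set part
  have hsplit : ∀ T ∈ Yf, lostInjWeight M p q φ Z T
      = (if Z ⊆ T ∧ T.ncard < p then 1 / ((T.ncard.choose q : ℕ) : ℚ) else 0)
        + ∑ S ∈ Lf, (if T.ncard < p then 0 else
            (if Z ⊆ S ∧ φ S = T then 1 / ((S.ncard.choose q : ℕ) : ℚ) else 0)) := by
    intro T hTY
    rw [hmemY] at hTY
    rw [Finset.sum_ite_irrel, Finset.sum_const_zero]
    unfold lostInjWeight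
    by_cases hsmall : T.ncard < p
    · rw [if_pos hsmall, if_pos hsmall, add_zero]
      unfold ruleLWeight
      by_cases hZT : Z ⊆ T
      · rw [if_pos ⟨hZ, hZT, hTY⟩, if_pos hsmall, if_pos ⟨hZT, hsmall⟩]
      · rw [if_neg (fun hc => hZT hc.2.1), if_neg (fun hc => hZT hc.1)]
    · rw [if_neg hsmall, if_neg hsmall, if_neg (fun hc => hsmall hc.2), zero_add]
  rw [Finset.sum_congr rfl hsplit, Finset.sum_add_distrib]
  -- the middle levels
  have hmid : ∑ T ∈ Yf, (if Z ⊆ T ∧ T.ncard < p then 1 / ((T.ncard.choose q : ℕ) : ℚ) else 0)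
      = ruleLMid M p q Z := by
    unfold ruleLMid
    rfl
  -- the big sets: each lost set through `Z` returns its LYM weight once, at `φ S`
  have hbig : ∑ T ∈ Yf, ∑ S ∈ Lf, (if T.ncard < p then 0 else
        (if Z ⊆ S ∧ φ S = T then 1 / ((S.ncard.choose q : ℕ) : ℚ) else 0))
      = lymDefect M p q Z := by
    rw [Finset.sum_comm]
    have hinner : ∀ S ∈ Lf, ∑ T ∈ Yf, (if T.ncard < p then 0 else
          (if Z ⊆ S ∧ φ S = T then 1 / ((S.ncard.choose q : ℕ) : ℚ) else 0))
        = if Z ⊆ S then 1 / ((S.ncard.choose q : ℕ) : ℚ) else 0 := by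
      intro S hSL
      rw [hmemL] at hSL
      obtain ⟨hφY, hφbig⟩ := hφ S hSL
      have hφYf : φ S ∈ Yf := (hmemY _).2 hφY.1
      have hpt : ∀ T ∈ Yf, (if T.ncard < p then 0 else
            (if Z ⊆ S ∧ φ S = T then 1 / ((S.ncard.choose q : ℕ) : ℚ) else 0))
          = if φ S = T then (if Z ⊆ S then 1 / ((S.ncard.choose q : ℕ) : ℚ) else 0) else 0 := by
        intro T _
        by_cases hT : φ S = T
        · have hnot : ¬ T.ncard < p := by rw [← hT]; exact not_lt.2 hφY.2
          rw [if_neg hnot, if_pos hT]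
          by_cases hZS : Z ⊆ S
          · rw [if_pos ⟨hZS, hT⟩, if_pos hZS]
          · rw [if_neg (fun hc => hZS hc.1), if_neg hZS]
        · rw [if_neg hT]
          by_cases hsmall : T.ncard < p
          · rw [if_pos hsmall]
          · rw [if_neg hsmall, if_neg (fun hc => hT hc.2)]
      rw [Finset.sum_congr rfl hpt, Finset.sum_ite_eq, if_pos hφYf]
    rw [Finset.sum_congr rfl hinner, ← Finset.sum_filter]
    exact sum_lost_through_eq_lymDefect M p q hE hpq hZ
  rw [hmid, hbig, ruleLMid_eq M p q hE hpq hZ]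
  ring

/-- **THE TRANSFER**: at the tight layer `#E = p + q` with `q < p`, an injection of the lost sets into the big `Y`-sets
(`LostInj M p q`) gives the UP-Hall condition for every family of members — Boolean LYM on the middle levels, the lost
sets replaced by their images. -/
theorem hallUp_of_ncard_eq_of_lostInj (p q : ℕ) (hE : M.E.ncard = p + q) (hpq : q < p) (h : LostInj M p q)
    (𝒜 : Set (Set α)) (h𝒜 : 𝒜 ⊆ cellMembers M p q) :
    phiK p q * (𝒜.ncard : ℚ) ≤ ((upNbhd M p q 𝒜).ncard : ℚ) := by
  obtain ⟨φ, hφ, hinj⟩ := h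
  refine hallUp_of_fracMatching M p q (lostInjWeight M p q φ) (lostInjWeight_nonneg M p q φ)
    (subset_of_lostInjWeight_ne_zero M p q φ (fun S hS => (hφ S hS).2)) ?_
    (lostInjWeight_load_le_one M p q hE φ hinj) 𝒜 h𝒜
  intro Z hZ
  rw [lostInjWeight_recv_eq_phiK M p q hE hpq φ hφ hZ]

end PercRepro
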